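import Mathlib.Analysis.SpecialFunctions.Complex.LogDeriv
import Mathlib.Analysis.SpecialFunctions.Complex.Arg
import HarnessLib

/-!
# The polar angle on the closed right half-plane, smoothly (analytic input for Kervaire–Milnor's rotation)

Topic `Literature/Topology/FourManifolds` (support). In Kervaire–Milnor's rotation construction
(*Groups of homotopy spheres I* (1963), proof of Lemma 2.4, p. 507) the half-disc
`H² = {(t sin θ, t cos θ) : 0 ≤ t ≤ 1, 0 ≤ θ ≤ π}` is parametrised by polar coordinates whose
angle `θ` ranges over the *closed* interval `[0, π]`; inverting the gluing map
`(i(tu), θ) ∼ (u, ((2t - 1) sin θ, (2t - 1) cos θ))` requires the angle as a *smooth* function of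
`(a, b) = (t sin θ, t cos θ)` on the whole punctured closed half-plane `{a ≥ 0} ∖ {0}`, including
the two boundary rays `θ = 0, π`. The principal argument of `b + a i` fails to be smooth on the
ray `θ = π`; rotating by a quarter turn fixes this: `θ = π/2 + arg (a - b i)`, and `a - b i` lies in
Mathlib's `Complex.slitPlane` whenever `a > 0` or `b ≠ 0`, in particular on `{a ≥ 0} ∖ {0}`.

* `Literature.halfPlaneAngle a b := π/2 + Complex.arg (a - b i)`;
* `halfPlaneAngle_polar`: `halfPlaneAngle (r sin θ) (r cos θ) = θ` for `r > 0`, `θ ∈ [0, π]`;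
* `sin_halfPlaneAngle`, `cos_halfPlaneAngle`: `sin θ = a/‖(a,b)‖`, `cos θ = b/‖(a,b)‖`;
* `halfPlaneAngle_mem_Icc`: `θ ∈ [0, π]` when `a ≥ 0`;
* `contDiffAt_halfPlaneAngle`: smooth at every `(a, b)` with `a > 0 ∨ b ≠ 0`.

## References

* M. Kervaire, J. Milnor, *Groups of homotopy spheres I*, Ann. of Math. 77 (1963), proof of
  Lemma 2.4, p. 507. [KervaireMilnorAnnals1963]
-/

open Real Complex

noncomputable section

namespace Literature.Topology.FourManifolds

/-- **The polar angle on the closed right half-plane**: `θ(a, b) = π/2 + arg (a - b i)`, so that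
`(a, b) = (r sin θ, r cos θ)` with `θ ∈ [0, π]` for `a ≥ 0` (Kervaire–Milnor's parametrisation of
the half-disc `H²`). [cite: KervaireMilnorAnnals1963, Lemma 2.4, proof (p. 507)] -/
def halfPlaneAngle (a b : ℝ) : ℝ := π / 2 + arg (a - b * I)

/-- The complex number `a - b i` used to measure the angle. [folklore] -/
theorem halfPlane_z_eq (a b : ℝ) : (a - b * I : ℂ) = ⟨a, -b⟩ := by
  apply Complex.ext <;> simp

/-- `a - b i ≠ 0` as soon as `(a, b) ≠ (0, 0)`. [folklore] -/
theorem halfPlane_z_ne_zero {a b : ℝ} (h : a ≠ 0 ∨ b ≠ 0) : (a - b * I : ℂ) ≠ 0 := by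
  rw [halfPlane_z_eq]
  intro hz
  have h1 := congrArg Complex.re hz
  have h2 := congrArg Complex.im hz
  simp at h1 h2
  rcases h with h | h
  · exact h h1
  · exact h h2

/-- `a - b i` lies in the slit plane as soon as `a > 0` or `b ≠ 0` — in particular on the punctured
closed right half-plane `{a ≥ 0} ∖ {0}`. [folklore] -/
theorem halfPlane_z_mem_slitPlane {a b : ℝ} (h : 0 < a ∨ b ≠ 0) : (a - b * I : ℂ) ∈ slitPlane := by
  rw [halfPlane_z_eq, mem_slitPlane_iff]
  rcases h with h | h
  · exact Or.inl h
  · refine Or.inr ?_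
    simpa using h

/-- On the punctured closed right half-plane, `a - b i` lies in the slit plane. [folklore] -/
theorem halfPlane_z_mem_slitPlane_of_nonneg {a b : ℝ} (ha : 0 ≤ a) (h : a ≠ 0 ∨ b ≠ 0) :
    (a - b * I : ℂ) ∈ slitPlane := by
  rcases h with h | h
  · exact halfPlane_z_mem_slitPlane (Or.inl (lt_of_le_of_ne ha (Ne.symm h)))
  · exact halfPlane_z_mem_slitPlane (Or.inr h)

/-- The norm of `a - b i` is `√(a² + b²)`. [folklore] -/
theorem norm_halfPlane_z (a b : ℝ) : ‖(a - b * I : ℂ)‖ = Real.sqrt (a ^ 2 + b ^ 2) := by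
  rw [halfPlane_z_eq, Complex.norm_def, Complex.normSq_mk]
  congr 1; ring

/-- **Polar coordinates are inverted by `halfPlaneAngle`**: for `r > 0` and `θ ∈ [0, π]`,
`halfPlaneAngle (r sin θ) (r cos θ) = θ` (`a - b i = r e^{i(θ - π/2)}` with
`θ - π/2 ∈ [-π/2, π/2]`). [folklore] -/
theorem halfPlaneAngle_polar {r θ : ℝ} (hr : 0 < r) (hθ : θ ∈ Set.Icc 0 π) :
    halfPlaneAngle (r * Real.sin θ) (r * Real.cos θ) = θ := by
  have key : ((r * Real.sin θ : ℝ) - (r * Real.cos θ : ℝ) * I : ℂ) =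
      r * (Complex.cos ↑(θ - π / 2) + Complex.sin ↑(θ - π / 2) * I) := by
    have hc : Complex.cos ↑(θ - π / 2) = Real.sin θ := by
      rw [← Complex.ofReal_cos, Real.cos_sub_pi_div_two]
    have hs : Complex.sin ↑(θ - π / 2) = -Real.cos θ := by
      rw [← Complex.ofReal_sin, Real.sin_sub_pi_div_two, Complex.ofReal_neg]
    rw [hc, hs]
    push_cast
    ring
  rw [halfPlaneAngle, key, Complex.arg_mul_cos_add_sin_mul_I hr ⟨by linarith [hθ.1, pi_pos],
    by linarith [hθ.2, pi_pos]⟩]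
  ring

/-- `sin (halfPlaneAngle a b) = a / √(a² + b²)` off the origin. [folklore] -/
theorem sin_halfPlaneAngle {a b : ℝ} (h : a ≠ 0 ∨ b ≠ 0) :
    Real.sin (halfPlaneAngle a b) = a / Real.sqrt (a ^ 2 + b ^ 2) := by
  rw [halfPlaneAngle, add_comm, Real.sin_add_pi_div_two, Complex.cos_arg (halfPlane_z_ne_zero h),
    norm_halfPlane_z]
  simp [halfPlane_z_eq]

/-- `cos (halfPlaneAngle a b) = b / √(a² + b²)` (at the origin both sides vanish). [folklore] -/
theorem cos_halfPlaneAngle (a b : ℝ) :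
    Real.cos (halfPlaneAngle a b) = b / Real.sqrt (a ^ 2 + b ^ 2) := by
  rw [halfPlaneAngle, add_comm, Real.cos_add_pi_div_two, Complex.sin_arg, norm_halfPlane_z]
  simp [halfPlane_z_eq, neg_div]

/-- On the closed right half-plane the angle lies in `[0, π]`. [folklore] -/
theorem halfPlaneAngle_mem_Icc {a b : ℝ} (ha : 0 ≤ a) : halfPlaneAngle a b ∈ Set.Icc 0 π := by
  have h1 : 0 ≤ (a - b * I : ℂ).re := by simp [ha]
  have h2 := Complex.abs_arg_le_pi_div_two_iff.2 h1
  rw [abs_le] at h2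
  constructor
  · rw [halfPlaneAngle]; linarith [h2.1]
  · rw [halfPlaneAngle]; linarith [h2.2]

/-- **The angle is smooth off the closed left ray**: `halfPlaneAngle` is `C^∞` (as a function of
`(a, b) ∈ ℝ × ℝ`) at every point with `a > 0` or `b ≠ 0`, in particular on the punctured closed
right half-plane; for there `a - b i` lies in the slit plane, where `arg = im ∘ log` is real
analytic. [folklore] -/
theorem contDiffAt_halfPlaneAngle {p : ℝ × ℝ} (h : 0 < p.1 ∨ p.2 ≠ 0) {n : WithTop ℕ∞} :
    ContDiffAt ℝ n (fun q : ℝ × ℝ => halfPlaneAngle q.1 q.2) p := by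
  have hz : ContDiff ℝ n (fun q : ℝ × ℝ => ((q.1 : ℂ) - (q.2 : ℂ) * I)) :=
    (Complex.ofRealCLM.contDiff.comp contDiff_fst).sub
      ((Complex.ofRealCLM.contDiff.comp contDiff_snd).mul contDiff_const)
  have hlog : ContDiffAt ℝ n (fun q : ℝ × ℝ => Complex.log ((q.1 : ℂ) - (q.2 : ℂ) * I)) p :=
    ContDiffAt.comp (g := Complex.log) p
      ((Complex.contDiffAt_log (halfPlane_z_mem_slitPlane h)).restrict_scalars ℝ) hz.contDiffAt
  have him : ContDiffAt ℝ n (fun q : ℝ × ℝ => (Complex.log ((q.1 : ℂ) - (q.2 : ℂ) * I)).im) p :=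
    Complex.imCLM.contDiff.contDiffAt.comp p hlog
  have hsum : ContDiffAt ℝ n
      (fun q : ℝ × ℝ => π / 2 + (Complex.log ((q.1 : ℂ) - (q.2 : ℂ) * I)).im) p :=
    contDiffAt_const.add him
  refine hsum.congr_of_eventuallyEq (Filter.Eventually.of_forall fun q => ?_)
  simp only [halfPlaneAngle, Complex.log_im]

end Literature.Topology.FourManifolds
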